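import Summits.QuantumFields.BalabanUV.Beta.D1BFx.LogDetSecondVariation
import Literature.MathematicalPhysics.QuantumFieldTheory.Balaban1983to89.Beta.GaugeFixing

/-!
# `BalabanUV.Beta.D1BFx.SliceTransferModel` — road «BF-x» for binder row D1, leaf K-R1 AT MODEL LEVEL (part 2):
# THE SECOND VARIATION OF THE LINEARISED FADDEEV–POPOV IDENTITIES — the one-loop functional of the AXIALLY SLICED bordered
# system equals that of the `P`-WEIGHTED bordered system PLUS twice the axial Gram's MINUS twice the Faddeev–Popov matrix's

HONEST DEPENDENCY (page 1, mandatory): continuum YM on T⁴ ⇐ BetaPertH ∧ nine spine estimates (0/9 proved); BetaPertH ⇐ (D1) ∧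
(D4) ∧ CAP+tail; G-an2-4 gates asym, D1 and NE2/3/4.  HONEST FRAMING (cell contract, verbatim): «discharging `BetaPertH` makes
Bałaban's UV stability UNCONDITIONAL — a real constructive-QFT result; it is NOT the continuum limit and NOT the Clay problem.»
THIS MODULE DISCHARGES NOTHING of the wall: [folklore] finite-dimensional calculus over the tree's `Beta.GaugeFixing` ((L1) weight ≡
constraint `det_kkt_add_weight`, (L2) slice change `det_kkt_fromRows_slice_change`) and part 1 (`LogDetSecondVariation`).  It is the
MODEL-LEVEL form of skeleton leaf R1/K-R1 (`HOME/beta/skeletons/D1-b2b-balaban-beta-d1-p2.md` v1.5; `OWNER-RULINGS-1.md` R-1, R-4 (v)):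
every hypothesis is displayed, nothing of Bałaban's operators is asserted, no `def … : Prop`, no cited fact, 0 sorry; 0 wall binders
touched; NOT D1, NOT BetaPertH, NOT continuum, NOT Clay.

ABSOLUTE RULE (cell charter, verbatim): «No internally-minted statement may enter as a cited fact. Every hypothesis is either
kernel-proved in this package or a verbatim quotation of a PUBLISHED theorem with page reference. The manuscript(s) under audit are NOT
citable for their own disputed steps — they are the thing under adjudication; programme-internal (2001/route/tribunal) claims are never
citable.»

THE STATEMENT (`secondVar_sliceTransfer`).  Data along a `C²` background curve `u ↦ (K(u), Q(u), P(u), W(u))` (first derivatives near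
`0`, second derivatives at `0`; all matrices real, finite): the fluctuation form `K`, Bałaban's averaging constraints `Q`, a
background-DEPENDENT slice `P` (on the road: the Landau-type slice `R_U D_U*` of B9 (3.21)–(3.26), CONTEXT only) and the residual gauge
directions `W` (columns), with a background-INDEPENDENT slice `τ` (on the road: the block axial gauge).  Hypotheses, near `u = 0`:
`K W = 0`, `Kᵀ W = 0` (gauge degeneracy of the form), `Q W = 0` (the constraints are blind to the residual directions); at `u = 0`:
`det(τ W) ≠ 0`, `det(P W) ≠ 0` (both slices transversal), `det kkt K [Q; τ] ≠ 0`.  Four composite curves and their 2-jets at `0`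
(product rule, §1): the AXIAL bordered system `M = kkt K [Q; τ]` (`M₁ = kkt K₁ [Q₁; 0]`, `M₂ = kkt K₂ [Q₂; 0]`), the `P`-WEIGHTED bordered
system `N = kkt (K + PᵀP) Q` (`N₁ = kkt (K₁ + P₁ᵀP + PᵀP₁) Q₁`, `N₂ = kkt (K₂ + P₂ᵀP + 2·P₁ᵀP₁ + PᵀP₂) Q₂` — the weight's jets CONTAIN
the product `2·P₁ᵀP₁` of first jets), the linearised FADDEEV–POPOV matrix `F = P W` (`F₁ = P₁W + PW₁`, `F₂ = P₂W + 2·P₁W₁ + PW₂`) and the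
axial GRAM `G = τ W` (`G₁ = τW₁`, `G₂ = τW₂`).  CONCLUSION, with part 1's `secondVar A₀ A₁ A₂ = tr(A₀⁻¹A₂) − tr(A₀⁻¹A₁A₀⁻¹A₁)`
(`= 2·(½·tadpole − ½·bubble)`):

    secondVar M + 2·secondVar F = secondVar N + 2·secondVar G      (at u = 0).

PROOF: the tree's determinant identities give `|det N|·|det G|² = |det M|·|det F|²` at every `u` near `0`; take logarithms and apply
part 1's `secondVar_comb_eq_zero`.  READING for the road (OWNER-RULINGS-1 R-4 (v), now a theorem at model level): in `hessKer` units the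
typed (axially sliced) one-loop kernel = the `P`-weighted reduced-bordered kernel (K-R2's datum, whose tables carry the weight's jets = J5)
MINUS 2 × the ghost functional of `F = PW` PLUS 2 × the functional of the axial Gram `τW` (which drops when `|det τW(u)|` is constant —
the tree-gauge case; kept displayed here).  The kernel-level transcription on ℤ⁴ (V1) and the identification of the typed tables as these
jets are NOT here.
-/

noncomputable section

namespace Summit.QuantumFields.BalabanUV.Beta.D1BFx.SliceTransferModel

open Matrix Filter Finset
open scoped Topology
open Literature.MathematicalPhysics.QuantumFieldTheory.Balaban1983to89.Beta.Composition (kkt)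
open Literature.MathematicalPhysics.QuantumFieldTheory.Balaban1983to89.Beta.GaugeFixing (det_kkt_add_weight det_kkt_fromRows_slice_change)
open Literature.Analysis.Calculus (eventually_det_ne_zero)
open Summit.QuantumFields.BalabanUV.Beta.D1BFx.LogDetSecondVariation (secondVar secondVar_comb_eq_zero)

/-! ## §1 Jets of composite matrix curves (product rule, entrywise)

Curves are `ℝ → ι → κ → ℝ` (the Pi type carries the norm); matrix expressions are moved into that type by `Matrix.of.symm` and read
back by `Matrix.of`, as in `Literature.Analysis.Calculus.MatrixFieldDeriv`. -/

section Curves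

variable {ι κ θ : Type*} [Fintype ι] [Fintype κ] [Fintype θ]

omit [Fintype ι] in
/-- [folklore] Entry derivative of a matrix curve. -/
theorem hasDerivAt_entry {X : ℝ → ι → κ → ℝ} {X' : ι → κ → ℝ} {t : ℝ} (hX : HasDerivAt X X' t) (i : ι) (k : κ) :
    HasDerivAt (fun u => X u i k) (X' i k) t :=
  (hasDerivAt_pi.1 ((hasDerivAt_pi.1 hX) i)) k

omit [Fintype ι] in
/-- [folklore] PRODUCT RULE for matrix curves: `(X·Y)′ = X′·Y + X·Y′`. -/
theorem hasDerivAt_matMul {X : ℝ → ι → θ → ℝ} {Y : ℝ → θ → κ → ℝ} {X' : Matrix ι θ ℝ} {Y' : Matrix θ κ ℝ} {t : ℝ}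
    (hX : HasDerivAt X (Matrix.of.symm X') t) (hY : HasDerivAt Y (Matrix.of.symm Y') t) :
    HasDerivAt (fun u => Matrix.of.symm (Matrix.of (X u) * Matrix.of (Y u)))
      (Matrix.of.symm (X' * Matrix.of (Y t) + Matrix.of (X t) * Y')) t := by
  refine hasDerivAt_pi.2 fun i => hasDerivAt_pi.2 fun k => ?_
  have h := HasDerivAt.fun_sum (u := (Finset.univ : Finset θ))
    (fun j _ => (hasDerivAt_entry hX i j).mul (hasDerivAt_entry hY j k))
  simp only [Matrix.of_symm_apply, Matrix.mul_apply, Matrix.add_apply, Matrix.of_apply]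
  rw [← Finset.sum_add_distrib]
  exact h

/-- [folklore] The transpose of a matrix curve. -/
theorem hasDerivAt_transpose {X : ℝ → ι → κ → ℝ} {X' : Matrix ι κ ℝ} {t : ℝ} (hX : HasDerivAt X (Matrix.of.symm X') t) :
    HasDerivAt (fun u => Matrix.of.symm (Matrix.of (X u))ᵀ) (Matrix.of.symm X'ᵀ) t := by
  refine hasDerivAt_pi.2 fun k => hasDerivAt_pi.2 fun i => ?_
  simp only [Matrix.of_symm_apply, Matrix.transpose_apply, Matrix.of_apply]
  exact hasDerivAt_entry hX i k

/-- [folklore] `(XᵀY)′ = X′ᵀY + XᵀY′`. -/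
theorem hasDerivAt_transpose_mul {X : ℝ → θ → ι → ℝ} {Y : ℝ → θ → κ → ℝ} {X' : Matrix θ ι ℝ} {Y' : Matrix θ κ ℝ} {t : ℝ}
    (hX : HasDerivAt X (Matrix.of.symm X') t) (hY : HasDerivAt Y (Matrix.of.symm Y') t) :
    HasDerivAt (fun u => Matrix.of.symm ((Matrix.of (X u))ᵀ * Matrix.of (Y u)))
      (Matrix.of.symm (X'ᵀ * Matrix.of (Y t) + (Matrix.of (X t))ᵀ * Y')) t :=
  hasDerivAt_matMul (X := fun u => Matrix.of.symm (Matrix.of (X u))ᵀ) (hasDerivAt_transpose hX) hY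

omit [Fintype ι] in
/-- [folklore] A constant left factor: `(τ·Y)′ = τ·Y′`. -/
theorem hasDerivAt_const_mul {Y : ℝ → θ → κ → ℝ} {Y' : Matrix θ κ ℝ} {t : ℝ} (τ : Matrix ι θ ℝ)
    (hY : HasDerivAt Y (Matrix.of.symm Y') t) :
    HasDerivAt (fun u => Matrix.of.symm (τ * Matrix.of (Y u))) (Matrix.of.symm (τ * Y')) t := by
  refine hasDerivAt_pi.2 fun i => hasDerivAt_pi.2 fun k => ?_
  simp only [Matrix.of_symm_apply, Matrix.mul_apply, Matrix.of_apply]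
  exact HasDerivAt.fun_sum fun j _ => (hasDerivAt_entry hY j k).const_mul (τ i j)

/-- [folklore] Sum of two matrix curves. -/
theorem hasDerivAt_matAdd {X Y : ℝ → ι → κ → ℝ} {X' Y' : Matrix ι κ ℝ} {t : ℝ}
    (hX : HasDerivAt X (Matrix.of.symm X') t) (hY : HasDerivAt Y (Matrix.of.symm Y') t) :
    HasDerivAt (fun u => Matrix.of.symm (Matrix.of (X u) + Matrix.of (Y u))) (Matrix.of.symm (X' + Y')) t :=
  hX.add hY

end Curves

section Bordered

variable {ν μ ρ : Type*} [Fintype ν] [Fintype μ] [Fintype ρ]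

/-- [folklore] **JETS OF THE DOUBLY BORDERED MATRIX**: `u ↦ kkt K(u) [Q(u); T(u)]` is entrywise LINEAR in `(K, Q, T)`, so its derivative is
`kkt K′ [Q′; T′]`. -/
theorem hasDerivAt_kkt_fromRows {K : ℝ → ν → ν → ℝ} {Q : ℝ → μ → ν → ℝ} {T : ℝ → ρ → ν → ℝ}
    {K' : Matrix ν ν ℝ} {Q' : Matrix μ ν ℝ} {T' : Matrix ρ ν ℝ} {t : ℝ}
    (hK : HasDerivAt K (Matrix.of.symm K') t) (hQ : HasDerivAt Q (Matrix.of.symm Q') t)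
    (hT : HasDerivAt T (Matrix.of.symm T') t) :
    HasDerivAt (fun u => Matrix.of.symm (kkt (Matrix.of (K u)) (fromRows (Matrix.of (Q u)) (Matrix.of (T u)))))
      (Matrix.of.symm (kkt K' (fromRows Q' T'))) t := by
  refine hasDerivAt_pi.2 fun a => hasDerivAt_pi.2 fun b => ?_
  rcases a with i | m | r <;> rcases b with j | m' | r' <;>
    simp only [kkt, Matrix.of_symm_apply, Matrix.fromBlocks_apply₁₁, Matrix.fromBlocks_apply₁₂, Matrix.fromBlocks_apply₂₁,
      Matrix.fromBlocks_apply₂₂, Matrix.transpose_apply, Matrix.fromRows_apply_inl, Matrix.fromRows_apply_inr, Matrix.of_apply,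
      Matrix.zero_apply]
  · exact hasDerivAt_entry hK i j
  · exact hasDerivAt_entry hQ m' i
  · exact hasDerivAt_entry hT r' i
  · exact hasDerivAt_entry hQ m j
  · exact hasDerivAt_const _ _
  · exact hasDerivAt_const _ _
  · exact hasDerivAt_entry hT r j
  · exact hasDerivAt_const _ _
  · exact hasDerivAt_const _ _

/-- [folklore] **JETS OF THE SINGLY BORDERED MATRIX**: the derivative of `u ↦ kkt H(u) Q(u)` is `kkt H′ Q′`. -/
theorem hasDerivAt_kkt {H : ℝ → ν → ν → ℝ} {Q : ℝ → μ → ν → ℝ} {H' : Matrix ν ν ℝ} {Q' : Matrix μ ν ℝ} {t : ℝ}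
    (hH : HasDerivAt H (Matrix.of.symm H') t) (hQ : HasDerivAt Q (Matrix.of.symm Q') t) :
    HasDerivAt (fun u => Matrix.of.symm (kkt (Matrix.of (H u)) (Matrix.of (Q u)))) (Matrix.of.symm (kkt H' Q')) t := by
  refine hasDerivAt_pi.2 fun a => hasDerivAt_pi.2 fun b => ?_
  rcases a with i | m <;> rcases b with j | m' <;>
    simp only [kkt, Matrix.of_symm_apply, Matrix.fromBlocks_apply₁₁, Matrix.fromBlocks_apply₁₂, Matrix.fromBlocks_apply₂₁,
      Matrix.fromBlocks_apply₂₂, Matrix.transpose_apply, Matrix.of_apply, Matrix.zero_apply]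
  · exact hasDerivAt_entry hH i j
  · exact hasDerivAt_entry hQ m' i
  · exact hasDerivAt_entry hQ m j
  · exact hasDerivAt_const _ _

/-! ## §2 The second variation of the slice-transfer identities -/

variable [DecidableEq ν] [DecidableEq μ] [DecidableEq ρ]

/-- [folklore] THE DETERMINANT IDENTITY BEHIND K-R1, absolute form (tree (L1) + (L2)): `K W = 0`, `Kᵀ W = 0`, `Q W = 0`, `τ W` and
`P W` invertible ⟹ `|det kkt (K + PᵀP) Q| · |det(τ W)|² = |det kkt K [Q; τ]| · |det(P W)|²`. -/
theorem absDet_sliceTransfer (K : Matrix ν ν ℝ) (Q : Matrix μ ν ℝ) (τ P : Matrix ρ ν ℝ) (W : Matrix ν ρ ℝ)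
    (hKW : K * W = 0) (hKtW : Kᵀ * W = 0) (hQW : Q * W = 0) (hT : (τ * W).det ≠ 0) (hS : (P * W).det ≠ 0) :
    |(kkt (K + Pᵀ * P) Q).det| * |(τ * W).det| ^ 2 = |(kkt K (fromRows Q τ)).det| * |(P * W).det| ^ 2 := by
  have h2 := det_kkt_fromRows_slice_change K Q τ P W hKW hKtW hQW (isUnit_iff_ne_zero.2 hT) (isUnit_iff_ne_zero.2 hS)
  have h1 := det_kkt_add_weight K Q P W (1 : Matrix ρ ρ ℝ) hKW hQW (isUnit_iff_ne_zero.2 hS) (by rw [det_one]; exact isUnit_one)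
  rw [Matrix.mul_one, det_one, mul_one] at h1
  rw [h1, abs_mul, abs_pow, abs_neg, abs_one, one_pow, one_mul, ← abs_pow, ← abs_pow, ← abs_mul, ← abs_mul, h2]

/-- [folklore] **THE SECOND VARIATION OF THE LINEARISED FADDEEV–POPOV IDENTITIES** (K-R1 at model level; all hypotheses displayed, see
the module docstring): along a `C²` background curve, at `u = 0`,
`secondVar M + 2·secondVar F = secondVar N + 2·secondVar G` for the axial bordered system `M = kkt K [Q; τ]`, the `P`-weighted bordered
system `N = kkt (K + PᵀP) Q`, the Faddeev–Popov matrix `F = P W` and the axial Gram `G = τ W`, with their 2-jets by the product rule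
(`N₂`'s form block is `K₂ + P₂ᵀP + 2·P₁ᵀP₁ + PᵀP₂`, `F₂ = P₂W + 2·P₁W₁ + PW₂`, written below as the product rule delivers them). -/
theorem secondVar_sliceTransfer
    {K K₁ : ℝ → ν → ν → ℝ} {K₂ : Matrix ν ν ℝ} {Q Q₁ : ℝ → μ → ν → ℝ} {Q₂ : Matrix μ ν ℝ}
    {P P₁ : ℝ → ρ → ν → ℝ} {P₂ : Matrix ρ ν ℝ} {W W₁ : ℝ → ν → ρ → ℝ} {W₂ : Matrix ν ρ ℝ} (τ : Matrix ρ ν ℝ)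
    (hK : ∀ᶠ u in 𝓝 (0 : ℝ), HasDerivAt K (K₁ u) u) (hK₁ : HasDerivAt K₁ (Matrix.of.symm K₂) 0)
    (hQ : ∀ᶠ u in 𝓝 (0 : ℝ), HasDerivAt Q (Q₁ u) u) (hQ₁ : HasDerivAt Q₁ (Matrix.of.symm Q₂) 0)
    (hP : ∀ᶠ u in 𝓝 (0 : ℝ), HasDerivAt P (P₁ u) u) (hP₁ : HasDerivAt P₁ (Matrix.of.symm P₂) 0)
    (hW : ∀ᶠ u in 𝓝 (0 : ℝ), HasDerivAt W (W₁ u) u) (hW₁ : HasDerivAt W₁ (Matrix.of.symm W₂) 0)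
    (hKW : ∀ᶠ u in 𝓝 (0 : ℝ), Matrix.of (K u) * Matrix.of (W u) = 0)
    (hKtW : ∀ᶠ u in 𝓝 (0 : ℝ), (Matrix.of (K u))ᵀ * Matrix.of (W u) = 0)
    (hQW : ∀ᶠ u in 𝓝 (0 : ℝ), Matrix.of (Q u) * Matrix.of (W u) = 0)
    (hτW : (τ * Matrix.of (W 0)).det ≠ 0) (hPW : (Matrix.of (P 0) * Matrix.of (W 0)).det ≠ 0)
    (hM : (kkt (Matrix.of (K 0)) (fromRows (Matrix.of (Q 0)) τ)).det ≠ 0) :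
    secondVar (kkt (Matrix.of (K 0)) (fromRows (Matrix.of (Q 0)) τ))
        (kkt (Matrix.of (K₁ 0)) (fromRows (Matrix.of (Q₁ 0)) (0 : Matrix ρ ν ℝ))) (kkt K₂ (fromRows Q₂ (0 : Matrix ρ ν ℝ)))
      + 2 * secondVar (Matrix.of (P 0) * Matrix.of (W 0))
        (Matrix.of (P₁ 0) * Matrix.of (W 0) + Matrix.of (P 0) * Matrix.of (W₁ 0))
        (P₂ * Matrix.of (W 0) + Matrix.of (P₁ 0) * Matrix.of (W₁ 0) + (Matrix.of (P₁ 0) * Matrix.of (W₁ 0) + Matrix.of (P 0) * W₂))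
    = secondVar (kkt (Matrix.of (K 0) + (Matrix.of (P 0))ᵀ * Matrix.of (P 0)) (Matrix.of (Q 0)))
        (kkt (Matrix.of (K₁ 0) + ((Matrix.of (P₁ 0))ᵀ * Matrix.of (P 0) + (Matrix.of (P 0))ᵀ * Matrix.of (P₁ 0))) (Matrix.of (Q₁ 0)))
        (kkt (K₂ + (P₂ᵀ * Matrix.of (P 0) + (Matrix.of (P₁ 0))ᵀ * Matrix.of (P₁ 0)
          + ((Matrix.of (P₁ 0))ᵀ * Matrix.of (P₁ 0) + (Matrix.of (P 0))ᵀ * P₂))) Q₂)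
      + 2 * secondVar (τ * Matrix.of (W 0)) (τ * Matrix.of (W₁ 0)) (τ * W₂) := by
  -- the first jets, read as matrices (`Matrix.of ∘ Matrix.of.symm = id` definitionally)
  have hK' : ∀ᶠ u in 𝓝 (0 : ℝ), HasDerivAt K (Matrix.of.symm (Matrix.of (K₁ u))) u := hK
  have hQ' : ∀ᶠ u in 𝓝 (0 : ℝ), HasDerivAt Q (Matrix.of.symm (Matrix.of (Q₁ u))) u := hQ
  have hP' : ∀ᶠ u in 𝓝 (0 : ℝ), HasDerivAt P (Matrix.of.symm (Matrix.of (P₁ u))) u := hP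
  have hW' : ∀ᶠ u in 𝓝 (0 : ℝ), HasDerivAt W (Matrix.of.symm (Matrix.of (W₁ u))) u := hW
  -- §1 jets of the four composite curves
  -- (M) axial bordered system
  have hMd : ∀ᶠ u in 𝓝 (0 : ℝ), HasDerivAt
      (fun u => Matrix.of.symm (kkt (Matrix.of (K u)) (fromRows (Matrix.of (Q u)) τ)))
      ((fun u => Matrix.of.symm (kkt (Matrix.of (K₁ u)) (fromRows (Matrix.of (Q₁ u)) (0 : Matrix ρ ν ℝ)))) u) u := by
    filter_upwards [hK', hQ'] with u huK huQ
    exact hasDerivAt_kkt_fromRows (T := fun _ => Matrix.of.symm τ) (T' := (0 : Matrix ρ ν ℝ)) huK huQ (hasDerivAt_const u _)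
  have hM₁d : HasDerivAt (fun u => Matrix.of.symm (kkt (Matrix.of (K₁ u)) (fromRows (Matrix.of (Q₁ u)) (0 : Matrix ρ ν ℝ))))
      (Matrix.of.symm (kkt K₂ (fromRows Q₂ (0 : Matrix ρ ν ℝ)))) 0 :=
    hasDerivAt_kkt_fromRows (T := fun _ => Matrix.of.symm (0 : Matrix ρ ν ℝ)) (T' := (0 : Matrix ρ ν ℝ)) hK₁ hQ₁
      (hasDerivAt_const (0 : ℝ) _)
  -- (F) Faddeev–Popov matrix
  have hFd : ∀ᶠ u in 𝓝 (0 : ℝ), HasDerivAt (fun u => Matrix.of.symm (Matrix.of (P u) * Matrix.of (W u)))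
      ((fun u => Matrix.of.symm (Matrix.of (P₁ u) * Matrix.of (W u) + Matrix.of (P u) * Matrix.of (W₁ u))) u) u := by
    filter_upwards [hP', hW'] with u huP huW
    exact hasDerivAt_matMul huP huW
  have hF₁d : HasDerivAt (fun u => Matrix.of.symm (Matrix.of (P₁ u) * Matrix.of (W u) + Matrix.of (P u) * Matrix.of (W₁ u)))
      (Matrix.of.symm (P₂ * Matrix.of (W 0) + Matrix.of (P₁ 0) * Matrix.of (W₁ 0)
        + (Matrix.of (P₁ 0) * Matrix.of (W₁ 0) + Matrix.of (P 0) * W₂))) 0 := by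
    have h := (hasDerivAt_matMul hP₁ hW'.self_of_nhds).add (hasDerivAt_matMul hP'.self_of_nhds hW₁)
    exact h
  -- (N) weighted bordered system
  have hNd : ∀ᶠ u in 𝓝 (0 : ℝ), HasDerivAt
      (fun u => Matrix.of.symm (kkt (Matrix.of (K u) + (Matrix.of (P u))ᵀ * Matrix.of (P u)) (Matrix.of (Q u))))
      ((fun u => Matrix.of.symm (kkt (Matrix.of (K₁ u) + ((Matrix.of (P₁ u))ᵀ * Matrix.of (P u)
        + (Matrix.of (P u))ᵀ * Matrix.of (P₁ u))) (Matrix.of (Q₁ u)))) u) u := by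
    filter_upwards [hK', hQ', hP'] with u huK huQ huP
    have h := hasDerivAt_kkt (H := fun u => Matrix.of.symm (Matrix.of (K u) + (Matrix.of (P u))ᵀ * Matrix.of (P u)))
      (huK.add (hasDerivAt_transpose_mul huP huP)) huQ
    exact h
  have hN₁d : HasDerivAt
      (fun u => Matrix.of.symm (kkt (Matrix.of (K₁ u) + ((Matrix.of (P₁ u))ᵀ * Matrix.of (P u)
        + (Matrix.of (P u))ᵀ * Matrix.of (P₁ u))) (Matrix.of (Q₁ u))))
      (Matrix.of.symm (kkt (K₂ + (P₂ᵀ * Matrix.of (P 0) + (Matrix.of (P₁ 0))ᵀ * Matrix.of (P₁ 0)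
          + ((Matrix.of (P₁ 0))ᵀ * Matrix.of (P₁ 0) + (Matrix.of (P 0))ᵀ * P₂))) Q₂)) 0 := by
    have h1 := hasDerivAt_transpose_mul hP₁ hP'.self_of_nhds
    have h2 := hasDerivAt_transpose_mul hP'.self_of_nhds hP₁
    have h := hasDerivAt_kkt (H := fun u => Matrix.of.symm (Matrix.of (K₁ u) + ((Matrix.of (P₁ u))ᵀ * Matrix.of (P u)
      + (Matrix.of (P u))ᵀ * Matrix.of (P₁ u)))) (hK₁.add (h1.add h2)) hQ₁
    exact h
  -- (G) axial Gram
  have hGd : ∀ᶠ u in 𝓝 (0 : ℝ), HasDerivAt (fun u => Matrix.of.symm (τ * Matrix.of (W u)))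
      ((fun u => Matrix.of.symm (τ * Matrix.of (W₁ u))) u) u := by
    filter_upwards [hW'] with u huW
    exact hasDerivAt_const_mul τ huW
  have hG₁d : HasDerivAt (fun u => Matrix.of.symm (τ * Matrix.of (W₁ u))) (Matrix.of.symm (τ * W₂)) 0 :=
    hasDerivAt_const_mul τ hW₁
  -- §2 nondegeneracy near 0 and the logarithmic identity
  have hFne : ∀ᶠ u in 𝓝 (0 : ℝ), (Matrix.of (Matrix.of.symm (Matrix.of (P u) * Matrix.of (W u)))).det ≠ 0 :=
    eventually_det_ne_zero hFd.self_of_nhds.hasFDerivAt hPW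
  have hGne : ∀ᶠ u in 𝓝 (0 : ℝ), (Matrix.of (Matrix.of.symm (τ * Matrix.of (W u)))).det ≠ 0 :=
    eventually_det_ne_zero hGd.self_of_nhds.hasFDerivAt hτW
  have hMne : ∀ᶠ u in 𝓝 (0 : ℝ), (Matrix.of (Matrix.of.symm (kkt (Matrix.of (K u)) (fromRows (Matrix.of (Q u)) τ)))).det ≠ 0 :=
    eventually_det_ne_zero hMd.self_of_nhds.hasFDerivAt hM
  have hlog : ∀ᶠ u in 𝓝 (0 : ℝ),
      1 * Real.log |(Matrix.of (Matrix.of.symm (kkt (Matrix.of (K u)) (fromRows (Matrix.of (Q u)) τ)))).det|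
      + 2 * Real.log |(Matrix.of (Matrix.of.symm (Matrix.of (P u) * Matrix.of (W u)))).det|
      + (-1) * Real.log |(Matrix.of (Matrix.of.symm (kkt (Matrix.of (K u) + (Matrix.of (P u))ᵀ * Matrix.of (P u)) (Matrix.of (Q u))))).det|
      + (-2) * Real.log |(Matrix.of (Matrix.of.symm (τ * Matrix.of (W u)))).det| = 0 := by
    filter_upwards [hKW, hKtW, hQW, hFne, hGne, hMne] with u huKW huKtW huQW huF huG huM
    have huF' : (Matrix.of (P u) * Matrix.of (W u)).det ≠ 0 := huF
    have huG' : (τ * Matrix.of (W u)).det ≠ 0 := huG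
    have huM' : (kkt (Matrix.of (K u)) (fromRows (Matrix.of (Q u)) τ)).det ≠ 0 := huM
    have hid := absDet_sliceTransfer (Matrix.of (K u)) (Matrix.of (Q u)) τ (Matrix.of (P u)) (Matrix.of (W u)) huKW huKtW huQW huG' huF'
    -- `|det N|·|det G|² = |det M|·|det F|²`, all factors positive
    have hFpos : 0 < |(Matrix.of (P u) * Matrix.of (W u)).det| := abs_pos.2 huF'
    have hGpos : 0 < |(τ * Matrix.of (W u)).det| := abs_pos.2 huG'
    have hMpos : 0 < |(kkt (Matrix.of (K u)) (fromRows (Matrix.of (Q u)) τ)).det| := abs_pos.2 huM'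
    have hNpos : 0 < |(kkt (Matrix.of (K u) + (Matrix.of (P u))ᵀ * Matrix.of (P u)) (Matrix.of (Q u))).det| := by
      refine abs_pos.2 fun h0 => ?_
      have h1 : |(kkt (Matrix.of (K u)) (fromRows (Matrix.of (Q u)) τ)).det| * |(Matrix.of (P u) * Matrix.of (W u)).det| ^ 2 = 0 := by
        rw [← hid, h0, abs_zero, zero_mul]
      have h2 : (0 : ℝ) < |(kkt (Matrix.of (K u)) (fromRows (Matrix.of (Q u)) τ)).det| * |(Matrix.of (P u) * Matrix.of (W u)).det| ^ 2 :=
        mul_pos hMpos (pow_pos hFpos 2)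
      linarith
    have hl := congrArg Real.log hid
    rw [Real.log_mul hNpos.ne' (pow_ne_zero 2 hGpos.ne'), Real.log_mul hMpos.ne' (pow_ne_zero 2 hFpos.ne'), Real.log_pow,
      Real.log_pow] at hl
    show 1 * Real.log |(kkt (Matrix.of (K u)) (fromRows (Matrix.of (Q u)) τ)).det| + 2 * Real.log |(Matrix.of (P u) * Matrix.of (W u)).det|
      + (-1) * Real.log |(kkt (Matrix.of (K u) + (Matrix.of (P u))ᵀ * Matrix.of (P u)) (Matrix.of (Q u))).det|
      + (-2) * Real.log |(τ * Matrix.of (W u)).det| = 0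
    push_cast at hl
    linarith
  -- `det N(0) ≠ 0` from the identity at `0`
  have hN : (Matrix.of (Matrix.of.symm (kkt (Matrix.of (K 0) + (Matrix.of (P 0))ᵀ * Matrix.of (P 0)) (Matrix.of (Q 0))))).det ≠ 0 := by
    have hid := absDet_sliceTransfer (Matrix.of (K 0)) (Matrix.of (Q 0)) τ (Matrix.of (P 0)) (Matrix.of (W 0))
      hKW.self_of_nhds hKtW.self_of_nhds hQW.self_of_nhds hτW hPW
    intro h0
    have h0' : (kkt (Matrix.of (K 0) + (Matrix.of (P 0))ᵀ * Matrix.of (P 0)) (Matrix.of (Q 0))).det = 0 := h0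
    have h1 : |(kkt (Matrix.of (K 0)) (fromRows (Matrix.of (Q 0)) τ)).det| * |(Matrix.of (P 0) * Matrix.of (W 0)).det| ^ 2 = 0 := by
      rw [← hid, h0', abs_zero, zero_mul]
    rcases mul_eq_zero.1 h1 with h2 | h2
    · exact hM (abs_eq_zero.1 h2)
    · exact hPW (abs_eq_zero.1 ((pow_eq_zero_iff two_ne_zero).1 h2))
  -- §3 differentiate twice (part 1) and rearrange
  have h := secondVar_comb_eq_zero (a := 1) (b := 2) (c := -1) (d := -2) (k := 0)
    hMd hM₁d hM hFd hF₁d hPW hNd hN₁d hN hGd hG₁d hτW hlog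
  have h' : 1 * secondVar (kkt (Matrix.of (K 0)) (fromRows (Matrix.of (Q 0)) τ))
        (kkt (Matrix.of (K₁ 0)) (fromRows (Matrix.of (Q₁ 0)) (0 : Matrix ρ ν ℝ))) (kkt K₂ (fromRows Q₂ (0 : Matrix ρ ν ℝ)))
      + 2 * secondVar (Matrix.of (P 0) * Matrix.of (W 0))
        (Matrix.of (P₁ 0) * Matrix.of (W 0) + Matrix.of (P 0) * Matrix.of (W₁ 0))
        (P₂ * Matrix.of (W 0) + Matrix.of (P₁ 0) * Matrix.of (W₁ 0) + (Matrix.of (P₁ 0) * Matrix.of (W₁ 0) + Matrix.of (P 0) * W₂))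
      + (-1) * secondVar (kkt (Matrix.of (K 0) + (Matrix.of (P 0))ᵀ * Matrix.of (P 0)) (Matrix.of (Q 0)))
        (kkt (Matrix.of (K₁ 0) + ((Matrix.of (P₁ 0))ᵀ * Matrix.of (P 0) + (Matrix.of (P 0))ᵀ * Matrix.of (P₁ 0))) (Matrix.of (Q₁ 0)))
        (kkt (K₂ + (P₂ᵀ * Matrix.of (P 0) + (Matrix.of (P₁ 0))ᵀ * Matrix.of (P₁ 0)
          + ((Matrix.of (P₁ 0))ᵀ * Matrix.of (P₁ 0) + (Matrix.of (P 0))ᵀ * P₂))) Q₂)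
      + (-2) * secondVar (τ * Matrix.of (W 0)) (τ * Matrix.of (W₁ 0)) (τ * W₂) = 0 := h
  linarith

end Bordered

end Summit.QuantumFields.BalabanUV.Beta.D1BFx.SliceTransferModel
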